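import Literature.Analysis.FluidPDE.TypeIAncientMild
import Literature.Analysis.FluidPDE.HyperbolicDSSOrbit
import Literature.Analysis.FluidPDE.AncientSimilarityVariables
import Literature.Analysis.FluidPDE.AncientSimilarityVorticity
import Literature.Analysis.FluidPDE.VorticityCalculus
import Literature.Analysis.FluidPDE.RadialSmoothCutoff
import Literature.Analysis.FluidPDE.NullLagrangianDeterminant
import Literature.Analysis.FluidPDE.LerayGaugeStrainSpectrum
import Literature.Analysis.FluidPDE.WholeSpaceIBP
import Literature.Analysis.FluidPDE.WholeSpaceIBPEnstrophy
import Literature.Analysis.FluidPDE.SpaceTimeCalculusC1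
import Literature.Analysis.FluidPDE.TypeIAncientMildClassical
import Summits.NavierStokesRegularity.NavierStokesRegularity.Theorems.SqueezeCycleMustSqueezeAlgebra
import Summits.NavierStokesRegularity.NavierStokesRegularity.Theorems.SqueezeCycleMustSqueezeEndgame
import Summits.NavierStokesRegularity.NavierStokesRegularity.Theorems.SqueezeCycleMustSqueezeGradEnergyBasic
import Summits.NavierStokesRegularity.NavierStokesRegularity.Theorems.SqueezeCycleMustSqueezeDivCurlBalls
import HarnessLib

/-!
# `MustSqueeze` — the lever `stub_signedBudget`, part 1: dictionary, production and flux bounds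

Helper file for item stmt-NavierStokesRegularity-11610 (route SqueezeCycle, crux `MustSqueeze`,
line outward-drift-signed-flux).  Read in backward similarity variables `U = lerayOrbit u`,
`Ω = lerayVorticity u`, with the radial ray-monotone cutoff `φ_R(y) = smoothTransition (2 − ‖y‖²/R²)`
of `RadialSmoothCutoff` and the ball gradient energy `E(ρ, s) = ∫_{B_ρ} ‖∇U(s)‖²_F`:

* regularity of the orbit slices; the dictionary `tr ∇U = 0`, `λ₂(sym ∇U(s,y)) ≤ a` from
  `lerayMiddleStrain u ≤ a` (Courant–Fischer both ways);
* `signedBudget_production_pointwise` — Betchov + Miller on the orbit: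
  `⟪∇U Ω, Ω⟫ ≤ 4 det ∇U + a (2‖∇U‖²_F − ‖Ω‖²)` (`Theorems.inner_fderiv_curl_le`);
* flux bounds against `φ_R`: cubic `|∫ φ_R det ∇U| ≤ ½ C (c₁/R) E(2R)` (null Lagrangian,
  `integral_mul_det_fderiv_eq`), transport `|∫ (U·∇φ_R)‖Ω‖²| ≤ 2C(c₁/R)E(2R)`, viscous
  `|∫ ‖Ω‖² Δφ_R| ≤ 2(c₂/R²)E(2R)`, and the SIGNED drift flux `∫ (y·∇φ_R)‖Ω‖² ≤ 0`.

The Lean proofs were written by the crux's standing refuter (drefute gen-2,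
`Cruxes/MustSqueeze/NegativeNotes-g2-StubSignedBudgetProof.lean`, namespace `DrefuteG2`) against the
lead's registered skeleton and are landed here by the line lead with attribution.
-/

noncomputable section

open MeasureTheory Set Filter Real Metric
open scoped ContDiff RealInnerProductSpace Laplacian
open Literature.Analysis.FluidPDE

set_option linter.dupNamespace false

namespace Summit.NavierStokesRegularity.NavierStokesRegularity.Theorems

/-- Physical / similarity space `ℝ³`. -/
local notation "ℝ³" => EuclideanSpace ℝ (Fin 3)

variable {C a : ℝ} {u : ℝ → ℝ³ → ℝ³}

/-! ## Regularity of the orbit (as in gen-1's StubBitsV3) -/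

-- adapted from Cruxes/MustSqueeze/NegativeNotes-g2-StubSignedBudgetProof.lean (namespace DrefuteG2)
/-- The vorticity of a slice is continuous. -/
theorem signedBudget_continuous_lerayVorticity (hu : IsTypeIAncientMild C u) (s : ℝ) :
    Continuous (lerayVorticity u s) := by
  rw [lerayVorticity_apply]
  exact continuous_curl (mustSqueeze_contDiff_lerayOrbit_slice hu s (n := 1))

/-! ## The dictionary: trace-free gradient, middle eigenvalue of the orbit -/

-- adapted from Cruxes/MustSqueeze/NegativeNotes-g2-StubSignedBudgetProof.lean (namespace DrefuteG2)
/-- `tr DU(s, y) = 0` (the orbit is divergence free). -/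
theorem signedBudget_trace_fderiv_lerayOrbit_eq_zero (hu : IsTypeIAncientMild C u) (s : ℝ) (y : ℝ³) :
    LinearMap.trace ℝ ℝ³ (fderiv ℝ (lerayOrbit u s) y : ℝ³ →ₗ[ℝ] ℝ³) = 0 := by
  have ht : -Real.exp (-s) < (0 : ℝ) := neg_neg_of_pos (Real.exp_pos _)
  exact (isDivFree_lerayOrbit_iff u s).2 (hu.isDivFree ht) y

-- adapted from Cruxes/MustSqueeze/NegativeNotes-g2-StubSignedBudgetProof.lean (namespace DrefuteG2)
/-- **`λ₂(sym DU(s,y)) ≤ a`** from `lerayMiddleStrain u ≤ a` (Courant–Fischer both ways: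
`DU(s,y) = e^{-s} • Du(t,x)` and `e^{-s} = -t`). -/
theorem signedBudget_strainEigenvalues_fderiv_lerayOrbit_le (hΛ : ∀ t < 0, ∀ x, lerayMiddleStrain u t x ≤ a)
    (s : ℝ) (y : ℝ³) :
    strainEigenvalues (fderiv ℝ (lerayOrbit u s) y : ℝ³ →ₗ[ℝ] ℝ³) finrank_euclideanSpace_fin 1 ≤ a := by
  have ht : -Real.exp (-s) < (0 : ℝ) := neg_neg_of_pos (Real.exp_pos _)
  obtain ⟨v, w, hv, hw, hvw, h⟩ :=
    (lerayMiddleStrain_le_iff ht a).1 (hΛ _ ht (Real.exp (-s / 2) • y))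
  refine (strainEigenvalues_mid_le_iff _ finrank_euclideanSpace_fin a).2 ⟨v, w, hv, hw, hvw, fun α β => ?_⟩
  have key := h α β
  rw [neg_neg] at key
  rw [ContinuousLinearMap.coe_coe, fderiv_lerayOrbit, FunLike.coe_smul, Pi.smul_apply,
    real_inner_smul_left]
  exact key

-- adapted from Cruxes/MustSqueeze/NegativeNotes-g2-StubSignedBudgetProof.lean (namespace DrefuteG2)
/-- **Pointwise production bound on the orbit**:
`⟪DU Ω, Ω⟫ ≤ 4 det DU + a (2 ‖DU‖²_F − ‖Ω‖²)` (`inner_fderiv_curl_le` with the dictionary, and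
`tr(DU ∘ DU) = ‖DU‖²_F − ‖Ω‖²`). -/
theorem signedBudget_production_pointwise (hu : IsTypeIAncientMild C u)
    (hΛ : ∀ t < 0, ∀ x, lerayMiddleStrain u t x ≤ a) (ha : 0 ≤ a) (s : ℝ) (y : ℝ³) :
    ⟪fderiv ℝ (lerayOrbit u s) y (lerayVorticity u s y), lerayVorticity u s y⟫ ≤
      4 * LinearMap.det (fderiv ℝ (lerayOrbit u s) y : ℝ³ →ₗ[ℝ] ℝ³) +
        a * (2 * frobeniusNormSq (fderiv ℝ (lerayOrbit u s) y) - ‖lerayVorticity u s y‖ ^ 2) := by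
  have key := Summit.NavierStokesRegularity.NavierStokesRegularity.Theorems.inner_fderiv_curl_le
    (v := lerayOrbit u s) (y := y) ha (signedBudget_trace_fderiv_lerayOrbit_eq_zero hu s y)
    (signedBudget_strainEigenvalues_fderiv_lerayOrbit_le hΛ s y)
  have hcurl := Summit.NavierStokesRegularity.NavierStokesRegularity.Theorems.norm_curl_sq_eq_frobeniusNormSq_sub_trace
    (lerayOrbit u s) y
  rw [lerayVorticity_apply]
  have e : frobeniusNormSq (fderiv ℝ (lerayOrbit u s) y) +
      LinearMap.trace ℝ ℝ³ ((fderiv ℝ (lerayOrbit u s) y : ℝ³ →ₗ[ℝ] ℝ³) ∘ₗ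
        (fderiv ℝ (lerayOrbit u s) y : ℝ³ →ₗ[ℝ] ℝ³)) =
      2 * frobeniusNormSq (fderiv ℝ (lerayOrbit u s) y) - ‖curl (lerayOrbit u s) y‖ ^ 2 := by
    linarith
  rw [← e]
  exact key

/-! ## The cutoff `φ_R` -/

-- adapted from Cruxes/MustSqueeze/NegativeNotes-g2-StubSignedBudgetProof.lean (namespace DrefuteG2)
/-- Off `closedBall 0 (2R)` the gradient of the cutoff vanishes. -/
theorem signedBudget_fderiv_cutoff_eq_zero {R : ℝ} (hR : 0 < R) {y : ℝ³} (hy : y ∉ closedBall (0 : ℝ³) (2 * R)) :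
    fderiv ℝ (fun z : ℝ³ => smoothTransition (2 - ‖z‖ ^ 2 / R ^ 2)) y = 0 :=
  fderiv_of_notMem_tsupport ℝ fun h => hy (mustSqueeze_tsupport_cutoff_subset hR h)

-- adapted from Cruxes/MustSqueeze/NegativeNotes-g2-StubSignedBudgetProof.lean (namespace DrefuteG2)
/-- Off `closedBall 0 (2R)` the Laplacian of the cutoff vanishes. -/
theorem signedBudget_laplacian_cutoff_eq_zero {R : ℝ} (hR : 0 < R) {y : ℝ³} (hy : y ∉ closedBall (0 : ℝ³) (2 * R)) :
    (Δ (fun z : ℝ³ => smoothTransition (2 - ‖z‖ ^ 2 / R ^ 2))) y = 0 :=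
  laplacian_eq_zero_of_notMem_tsupport fun h => hy (mustSqueeze_tsupport_cutoff_subset hR h)

-- adapted from Cruxes/MustSqueeze/NegativeNotes-g2-StubSignedBudgetProof.lean (namespace DrefuteG2)
/-- `‖∇φ‖ = ‖Dφ‖`. -/
theorem signedBudget_norm_gradient_eq (φ : ℝ³ → ℝ) (y : ℝ³) : ‖gradient φ y‖ = ‖fderiv ℝ φ y‖ := by
  rw [gradient, LinearIsometryEquiv.norm_map]


/-! ## Flux bounds against `φ_R` -/

section Flux

variable (hu : IsTypeIAncientMild C u)

-- adapted from Cruxes/MustSqueeze/NegativeNotes-g2-StubSignedBudgetProof.lean (namespace DrefuteG2)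
/-- A continuous function vanishing off `closedBall 0 ρ` is integrable, and its integral is the
integral over the closed ball. -/
theorem signedBudget_integrable_of_continuous_of_eq_zero {f : ℝ³ → ℝ} (hf : Continuous f) {ρ : ℝ}
    (h0 : ∀ y ∉ closedBall (0 : ℝ³) ρ, f y = 0) : Integrable f :=
  hf.integrable_of_hasCompactSupport (HasCompactSupport.intro (isCompact_closedBall _ _) h0)

-- adapted from Cruxes/MustSqueeze/NegativeNotes-g2-StubSignedBudgetProof.lean (namespace DrefuteG2)
/-- `∫_{closedBall 0 ρ} k · frob = k · E(ρ)`. -/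
theorem signedBudget_setIntegral_closedBall_const_mul_frob (u : ℝ → ℝ³ → ℝ³) (k ρ s : ℝ) :
    ∫ y in closedBall (0 : ℝ³) ρ, k * frobeniusNormSq (fderiv ℝ (lerayOrbit u s) y) =
      k * ∫ y in ball (0 : ℝ³) ρ, frobeniusNormSq (fderiv ℝ (lerayOrbit u s) y) := by
  rw [integral_const_mul, setIntegral_congr_set (mustSqueeze_ball_ae_eq_closedBall ρ)]

include hu in
-- adapted from Cruxes/MustSqueeze/NegativeNotes-g2-StubSignedBudgetProof.lean (namespace DrefuteG2)
/-- **Generic collar estimate**: if `|g| ≤ w · frob` pointwise with a continuous weight `w ≥ 0`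
vanishing off `closedBall 0 (2R)` and bounded by `m` there, then `|∫ g| ≤ m · E(2R)`. -/
theorem signedBudget_abs_integral_le_of_weight {g w : ℝ³ → ℝ} {R m : ℝ} (s : ℝ) (hw : Continuous w)
    (hw0 : ∀ y ∉ closedBall (0 : ℝ³) (2 * R), w y = 0) (hwm : ∀ y ∈ closedBall (0 : ℝ³) (2 * R), w y ≤ m)
    (hg : ∀ y, |g y| ≤ w y * frobeniusNormSq (fderiv ℝ (lerayOrbit u s) y)) :
    |∫ y, g y| ≤ m * ∫ y in ball (0 : ℝ³) (2 * R), frobeniusNormSq (fderiv ℝ (lerayOrbit u s) y) := by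
  set F : ℝ³ → ℝ := fun y => frobeniusNormSq (fderiv ℝ (lerayOrbit u s) y) with hF
  have hFc : Continuous F := mustSqueeze_continuous_frobeniusNormSq_fderiv_lerayOrbit hu s
  have hF0 : ∀ y, 0 ≤ F y := fun y => frobeniusNormSq_nonneg _
  -- the majorant `w · F` is integrable (continuous, vanishes off the closed ball)
  have hG0 : ∀ y ∉ closedBall (0 : ℝ³) (2 * R), w y * F y = 0 := fun y hy => by rw [hw0 y hy, zero_mul]
  have hGi : Integrable fun y => w y * F y := signedBudget_integrable_of_continuous_of_eq_zero (hw.mul hFc) hG0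
  have h1 : |∫ y, g y| ≤ ∫ y, w y * F y := by
    have := norm_integral_le_of_norm_le hGi (Eventually.of_forall fun y => by
      rw [Real.norm_eq_abs]; exact hg y)
    simpa only [Real.norm_eq_abs] using this
  have h2 : (∫ y, w y * F y) = ∫ y in closedBall (0 : ℝ³) (2 * R), w y * F y :=
    (setIntegral_eq_integral_of_forall_compl_eq_zero hG0).symm
  have hmi : IntegrableOn (fun y => m * F y) (closedBall (0 : ℝ³) (2 * R)) :=
    ((continuous_const.mul hFc).continuousOn).integrableOn_compact (isCompact_closedBall _ _)
  have h3 : (∫ y in closedBall (0 : ℝ³) (2 * R), w y * F y) ≤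
      ∫ y in closedBall (0 : ℝ³) (2 * R), m * F y :=
    setIntegral_mono_on hGi.integrableOn hmi measurableSet_closedBall fun y hy =>
      mul_le_mul_of_nonneg_right (hwm y hy) (hF0 y)
  rw [signedBudget_setIntegral_closedBall_const_mul_frob u] at h3
  linarith

include hu in
-- adapted from Cruxes/MustSqueeze/NegativeNotes-g2-StubSignedBudgetProof.lean (namespace DrefuteG2)
/-- **Cubic (null-Lagrangian) flux**: `|∫ φ_R det DU| ≤ ½ C (c₁/R) E(2R)`. -/
theorem signedBudget_cubic_flux_le (hUC : ∀ (s : ℝ) (y : ℝ³), ‖lerayOrbit u s y‖ ≤ C) {c₁ : ℝ}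
    (hc₁ : ∀ R : ℝ, 0 < R → ∀ y : ℝ³,
      ‖fderiv ℝ (fun z : ℝ³ => smoothTransition (2 - ‖z‖ ^ 2 / R ^ 2)) y‖ ≤ c₁ / R)
    {R : ℝ} (hR : 0 < R) (s : ℝ) :
    |∫ y, smoothTransition (2 - ‖y‖ ^ 2 / R ^ 2) *
        LinearMap.det (fderiv ℝ (lerayOrbit u s) y : ℝ³ →ₗ[ℝ] ℝ³)| ≤
      (1 / 2) * C * (c₁ / R) * ∫ y in ball (0 : ℝ³) (2 * R), frobeniusNormSq (fderiv ℝ (lerayOrbit u s) y) := by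
  have hC : 0 ≤ C := hu.nonneg
  set φ : ℝ³ → ℝ := fun z => smoothTransition (2 - ‖z‖ ^ 2 / R ^ 2) with hφdef
  have hφ : ContDiff ℝ ∞ φ := contDiff_smoothTransition_cutoff (n := ⊤) R
  have hφ1 : ContDiff ℝ 1 φ := contDiff_smoothTransition_cutoff (n := 1) R
  have hφc : HasCompactSupport φ := hasCompactSupport_smoothTransition_cutoff hR
  have hU : ContDiff ℝ ∞ (lerayOrbit u s) := mustSqueeze_contDiff_lerayOrbit_slice hu s
  have hUd : ∀ y, DifferentiableAt ℝ (lerayOrbit u s) y := fun y =>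
    (mustSqueeze_contDiff_lerayOrbit_slice hu s (n := 1)).differentiable one_ne_zero y
  rw [show (fun y => smoothTransition (2 - ‖y‖ ^ 2 / R ^ 2) *
      LinearMap.det (fderiv ℝ (lerayOrbit u s) y : ℝ³ →ₗ[ℝ] ℝ³)) = fun y => φ y *
      LinearMap.det (fderiv ℝ (lerayOrbit u s) y : ℝ³ →ₗ[ℝ] ℝ³) from rfl,
    integral_mul_det_fderiv_eq hU hφ hφc, abs_neg]
  -- weight `w = ½ C ‖Dφ‖`
  refine signedBudget_abs_integral_le_of_weight hu s (w := fun y => (1 / 2) * C * ‖fderiv ℝ φ y‖)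
    (continuous_const.mul (hφ1.continuous_fderiv one_ne_zero).norm) (fun y hy => ?_) (fun y _ => ?_)
    (fun y => ?_)
  · show (1 / 2) * C * ‖fderiv ℝ φ y‖ = 0
    rw [hφdef, signedBudget_fderiv_cutoff_eq_zero hR hy, norm_zero, mul_zero]
  · show (1 / 2) * C * ‖fderiv ℝ φ y‖ ≤ (1 / 2) * C * (c₁ / R)
    exact mul_le_mul_of_nonneg_left (hc₁ R hR y) (by positivity)
  · calc |lerayOrbit u s y 0 * ⟪cross (gradient (fun z => lerayOrbit u s z 1) y)
          (gradient (fun z => lerayOrbit u s z 2) y), gradient φ y⟫|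
        ≤ (1 / 2) * ‖lerayOrbit u s y‖ * ‖gradient φ y‖ * frobeniusNormSq (fderiv ℝ (lerayOrbit u s) y) :=
          abs_mul_inner_cross_gradient_le (hUd y) φ
      _ ≤ (1 / 2) * C * ‖fderiv ℝ φ y‖ * frobeniusNormSq (fderiv ℝ (lerayOrbit u s) y) := by
          rw [signedBudget_norm_gradient_eq]
          have hf0 : 0 ≤ frobeniusNormSq (fderiv ℝ (lerayOrbit u s) y) := frobeniusNormSq_nonneg _
          have hn0 : 0 ≤ ‖fderiv ℝ φ y‖ := norm_nonneg _
          have := hUC s y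
          gcongr

include hu in
-- adapted from Cruxes/MustSqueeze/NegativeNotes-g2-StubSignedBudgetProof.lean (namespace DrefuteG2)
/-- **Transport flux**: `|∫ (U·∇φ_R) ‖Ω‖²| ≤ 2 C (c₁/R) E(2R)`. -/
theorem signedBudget_transport_flux_le (hUC : ∀ (s : ℝ) (y : ℝ³), ‖lerayOrbit u s y‖ ≤ C) {c₁ : ℝ}
    (hc₁ : ∀ R : ℝ, 0 < R → ∀ y : ℝ³,
      ‖fderiv ℝ (fun z : ℝ³ => smoothTransition (2 - ‖z‖ ^ 2 / R ^ 2)) y‖ ≤ c₁ / R)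
    {R : ℝ} (hR : 0 < R) (s : ℝ) :
    |∫ y, fderiv ℝ (fun z : ℝ³ => smoothTransition (2 - ‖z‖ ^ 2 / R ^ 2)) y (lerayOrbit u s y) *
        ‖lerayVorticity u s y‖ ^ 2| ≤
      2 * C * (c₁ / R) * ∫ y in ball (0 : ℝ³) (2 * R), frobeniusNormSq (fderiv ℝ (lerayOrbit u s) y) := by
  have hC : 0 ≤ C := hu.nonneg
  set φ : ℝ³ → ℝ := fun z => smoothTransition (2 - ‖z‖ ^ 2 / R ^ 2) with hφdef
  have hφ1 : ContDiff ℝ 1 φ := contDiff_smoothTransition_cutoff (n := 1) R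
  refine signedBudget_abs_integral_le_of_weight hu s (w := fun y => 2 * C * ‖fderiv ℝ φ y‖)
    (continuous_const.mul (hφ1.continuous_fderiv one_ne_zero).norm) (fun y hy => ?_) (fun y _ => ?_)
    (fun y => ?_)
  · show 2 * C * ‖fderiv ℝ φ y‖ = 0
    rw [hφdef, signedBudget_fderiv_cutoff_eq_zero hR hy, norm_zero, mul_zero]
  · show 2 * C * ‖fderiv ℝ φ y‖ ≤ 2 * C * (c₁ / R)
    exact mul_le_mul_of_nonneg_left (hc₁ R hR y) (by positivity)
  · have h1 : |fderiv ℝ φ y (lerayOrbit u s y)| ≤ ‖fderiv ℝ φ y‖ * C := by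
      rw [← Real.norm_eq_abs]
      exact (ContinuousLinearMap.le_opNorm _ _).trans
        (mul_le_mul_of_nonneg_left (hUC s y) (norm_nonneg _))
    have h2 : ‖lerayVorticity u s y‖ ^ 2 ≤ 2 * frobeniusNormSq (fderiv ℝ (lerayOrbit u s) y) := by
      rw [lerayVorticity_apply]; exact norm_curl_sq_le_two_mul_frobeniusNormSq _ _
    rw [abs_mul, abs_of_nonneg (sq_nonneg ‖lerayVorticity u s y‖)]
    have hn0 : 0 ≤ ‖fderiv ℝ φ y‖ * C := by positivity
    calc |fderiv ℝ φ y (lerayOrbit u s y)| * ‖lerayVorticity u s y‖ ^ 2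
        ≤ (‖fderiv ℝ φ y‖ * C) * (2 * frobeniusNormSq (fderiv ℝ (lerayOrbit u s) y)) :=
          mul_le_mul h1 h2 (sq_nonneg _) hn0
      _ = 2 * C * ‖fderiv ℝ φ y‖ * frobeniusNormSq (fderiv ℝ (lerayOrbit u s) y) := by ring

include hu in
-- adapted from Cruxes/MustSqueeze/NegativeNotes-g2-StubSignedBudgetProof.lean (namespace DrefuteG2)
/-- **Viscous flux**: `|∫ ‖Ω‖² Δφ_R| ≤ 2 (c₂/R²) E(2R)`. -/
theorem signedBudget_viscous_flux_le {c₂ : ℝ}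
    (hc₂ : ∀ R : ℝ, 0 < R → ∀ y : ℝ³,
      |(Δ (fun z : ℝ³ => smoothTransition (2 - ‖z‖ ^ 2 / R ^ 2))) y| ≤ c₂ / R ^ 2)
    {R : ℝ} (hR : 0 < R) (s : ℝ) :
    |∫ y, ‖lerayVorticity u s y‖ ^ 2 * (Δ (fun z : ℝ³ => smoothTransition (2 - ‖z‖ ^ 2 / R ^ 2))) y| ≤
      2 * (c₂ / R ^ 2) * ∫ y in ball (0 : ℝ³) (2 * R), frobeniusNormSq (fderiv ℝ (lerayOrbit u s) y) := by
  set φ : ℝ³ → ℝ := fun z => smoothTransition (2 - ‖z‖ ^ 2 / R ^ 2) with hφdef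
  have hφ2 : ContDiff ℝ 2 φ := contDiff_smoothTransition_cutoff (n := 2) R
  refine signedBudget_abs_integral_le_of_weight hu s (w := fun y => 2 * |(Δ φ) y|)
    (continuous_const.mul (continuous_laplacian hφ2).abs) (fun y hy => ?_) (fun y _ => ?_)
    (fun y => ?_)
  · show 2 * |(Δ φ) y| = 0
    rw [hφdef, signedBudget_laplacian_cutoff_eq_zero hR hy, abs_zero, mul_zero]
  · show 2 * |(Δ φ) y| ≤ 2 * (c₂ / R ^ 2)
    exact mul_le_mul_of_nonneg_left (hc₂ R hR y) zero_le_two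
  · have h2 : ‖lerayVorticity u s y‖ ^ 2 ≤ 2 * frobeniusNormSq (fderiv ℝ (lerayOrbit u s) y) := by
      rw [lerayVorticity_apply]; exact norm_curl_sq_le_two_mul_frobeniusNormSq _ _
    rw [abs_mul, abs_of_nonneg (sq_nonneg ‖lerayVorticity u s y‖)]
    have ha0 : 0 ≤ |(Δ φ) y| := abs_nonneg _
    calc ‖lerayVorticity u s y‖ ^ 2 * |(Δ φ) y|
        ≤ (2 * frobeniusNormSq (fderiv ℝ (lerayOrbit u s) y)) * |(Δ φ) y| :=
          mul_le_mul_of_nonneg_right h2 ha0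
      _ = 2 * |(Δ φ) y| * frobeniusNormSq (fderiv ℝ (lerayOrbit u s) y) := by ring

-- adapted from Cruxes/MustSqueeze/NegativeNotes-g2-StubSignedBudgetProof.lean (namespace DrefuteG2)
/-- **Drift flux sign**: `∫ (y·∇φ_R) ‖Ω‖² ≤ 0` (ray monotonicity of the cutoff). -/
theorem signedBudget_drift_flux_nonpos (u : ℝ → ℝ³ → ℝ³) (R s : ℝ) :
    (∫ y, fderiv ℝ (fun z : ℝ³ => smoothTransition (2 - ‖z‖ ^ 2 / R ^ 2)) y y *
        ‖lerayVorticity u s y‖ ^ 2) ≤ 0 :=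
  integral_nonpos fun y => mul_nonpos_of_nonpos_of_nonneg
    (fderiv_smoothTransition_cutoff_self_nonpos R y) (sq_nonneg _)

end Flux


/-- **Registered sub-goal `stub_signedBudgetFlux`** (closed form of `signedBudget_production_pointwise`):
Betchov's sign law with Miller's middle-eigenvalue bound on the similarity orbit — for a class element
with `Λ_u ≤ a`, `0 ≤ a`: `⟪∇U Ω, Ω⟫ ≤ 4 det ∇U + a (2‖∇U‖²_F − ‖Ω‖²)` pointwise. -/
theorem stub_signedBudgetFlux : ∀ (C a : ℝ) (u : ℝ → ℝ³ → ℝ³), IsTypeIAncientMild C u →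
    (∀ t < 0, ∀ x, lerayMiddleStrain u t x ≤ a) → 0 ≤ a → ∀ (s : ℝ) (y : ℝ³),
      inner ℝ (fderiv ℝ (lerayOrbit u s) y (lerayVorticity u s y)) (lerayVorticity u s y) ≤
        4 * LinearMap.det (fderiv ℝ (lerayOrbit u s) y : ℝ³ →ₗ[ℝ] ℝ³) +
          a * (2 * frobeniusNormSq (fderiv ℝ (lerayOrbit u s) y) - ‖lerayVorticity u s y‖ ^ 2) :=
  fun _ _ _ hu hΛ ha s y => signedBudget_production_pointwise hu hΛ ha s y

end Summit.NavierStokesRegularity.NavierStokesRegularity.Theorems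

end
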